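import Summits.CriticalPhenomena.CardyFormulaZ2.Theses.CardySelfRefinement
import Summits.CriticalPhenomena.CardyFormulaZ2.Theorems.CardySelfRefinementLagHandOffExplorationPrefix
import Summits.CriticalPhenomena.CardyFormulaZ2.Theorems.CardySelfRefinementLagHandOffChordal
import Literature.Probability.Percolation.LoopRotationInvarianceAssembly
import Literature.Probability.LatticeModels.CornerPermutation
import HarnessLib

/-!
# Exploration suffixes: groundwork for stub `stub_discreteLocality` of line `crosscut-dictionary`
for crux `LagHandOff` (stmt-CriticalPhenomena-10268), backward half

Registered sub-goal stub `stub_discreteLocality_explorationSuffix`, companion of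
`…ExplorationPrefix.lean`.  WHY: G02's medial exploration keeps the wired arc `A = D.arc 0` on
its LEFT, so for a positively oriented boundary loop it runs from (near) `b` to (near) `a` and
`bondInterfaceIn` time-reverses it (`orientCurve_of_lt`), while `stub_discreteLocality` compares
INITIAL segments from `a`.  `nextCorner β` is injective, so explorations of admissible `E₁`, `E₂`
with a common END corner (an `ω`-free datum, `cornerOrbit_eq_endCorner`) agree BACKWARDS while
the statuses of the source edges read agree (`cornerOrbit_sub_eq_of_agree`); the REVERSED vertex
lists share a prefix (`medialExploration_reverse_take_eq`), their polylines agree as parametrised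
curves up to the dyadic prefix time and represent the time-reversed classes
(`reparamDist_polyline_reverse`): `exists_commonPrefix_bondInterfaceIn_rev`; with `U`-compatible
data the first backward divergence sits at a vertex outside `U`
(`bondInterfaceIn_eq_or_commonPrefix_rev`).  Not here (XL): compatible admissible families.
-/

noncomputable section

open MeasureTheory Filter Set Topology
open scoped BoundedContinuousFunction
open Literature.Probability.Percolation Literature.Probability.LatticeModels
open Literature.Probability.RandomPlanarGeometry Literature.Probability.Percolation.QuadCrossing
open Summit.CriticalPhenomena.CardyFormulaZ2.Theses.CardySelfRefinement

namespace Summit.CriticalPhenomena.CardyFormulaZ2.Cruxes.LagHandOff.CrosscutDictionary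

/-! ### Backward orbit agreement (injectivity of the successor map) -/

/-- **Backward orbit agreement.** If two orbits are at the same corner at times `N₁`, `N₂` and,
going backwards, the statuses of the source edges of the corners met agree for `j < k` steps,
then the orbits agree at the times `N₁ - j`, `N₂ - j`, `j ≤ k` (`nextCorner` is injective and
reads only the status of the edge between two consecutive corners). (Smirnov 2001, §2.) -/
theorem cornerOrbit_sub_eq_of_agree (β₁ β₂ : BondConfig (Site 2)) (c₁ c₂ : Site 2 × Fin 4)
    {N₁ N₂ k : ℕ} (hk₁ : k ≤ N₁) (hk₂ : k ≤ N₂)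
    (hend : cornerOrbit β₁ c₁ N₁ = cornerOrbit β₂ c₂ N₂)
    (h : ∀ j < k, (cSrc (cornerOrbit β₁ c₁ (N₁ - j)) ∈ β₁ ↔
      cSrc (cornerOrbit β₁ c₁ (N₁ - j)) ∈ β₂)) :
    ∀ j ≤ k, cornerOrbit β₁ c₁ (N₁ - j) = cornerOrbit β₂ c₂ (N₂ - j) := by
  intro j hj
  induction j with
  | zero => simpa using hend
  | succ j ih =>
    have e₁ : cornerOrbit β₁ c₁ (N₁ - j) = nextCorner β₁ (cornerOrbit β₁ c₁ (N₁ - (j + 1))) := by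
      rw [show N₁ - j = N₁ - (j + 1) + 1 by omega]; rfl
    have e₂ : cornerOrbit β₂ c₂ (N₂ - j) = nextCorner β₂ (cornerOrbit β₂ c₂ (N₂ - (j + 1))) := by
      rw [show N₂ - j = N₂ - (j + 1) + 1 by omega]; rfl
    set p₁ := cornerOrbit β₁ c₁ (N₁ - (j + 1))
    have hstat : (cTgt p₁ ∈ β₁ ↔ cTgt p₁ ∈ β₂) := by
      have := h j (Nat.lt_of_succ_le hj)
      rwa [e₁, cSrc_nextCorner] at this
    have hnext : nextCorner β₂ p₁ = nextCorner β₁ p₁ := by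
      by_cases hm : cTgt p₁ ∈ β₁
      · rw [nextCorner_of_mem hm, nextCorner_of_mem (hstat.1 hm)]
      · rw [nextCorner_of_not_mem hm, nextCorner_of_not_mem fun h' => hm (hstat.2 h')]
    apply nextCorner_injective (β := β₂)
    rw [hnext, ← e₁, ← e₂, ih (Nat.le_of_succ_le hj)]

/-- `Fin 4` arithmetic: the face before `k` is `k + 3`. -/
theorem fin4_eq_add_three_of_add_one_eq {j k : Fin 4} (h : j + 1 = k) : j = k + 3 := by
  revert j k; decide

/-- A corner mapped by the successor map onto a corner `c` with CLOSED source edge is the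
cross-predecessor `(c.1, c.2 + 3)` of `c` (same vertex, previous face). -/
theorem eq_crossPred_of_nextCorner_eq {β : BondConfig (Site 2)} {p c : Site 2 × Fin 4}
    (hn : nextCorner β p = c) (hclosed : cSrc c ∉ β) : p = (c.1, c.2 + 3) := by
  have ht : cTgt p ∉ β := by rw [← cSrc_nextCorner, hn]; exact hclosed
  rw [nextCorner_of_not_mem ht, Prod.ext_iff] at hn
  exact Prod.ext hn.1 (fin4_eq_add_three_of_add_one_eq hn.2)

/-! ### The end corner of admissible data -/

/-- **The last dart of the exploration is carried by the end corner.** The corner `orb N` of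
the last dart has its vertex on `A`, the far endpoint of its target edge on `B`, and its target
edge targeted at the vertex (`cornerOrbit_exit`); these `ω`-free properties determine it (two
`A`–`B` edges, `e_a` sourced at its `A`-end; `eq_of_cSrc_eq_of_arcs`). (Smirnov 2001, §2.) -/
theorem cornerOrbit_eq_endCorner {E : DiscreteDobrushin} (hE : E.IsZdAdmissible)
    {c₀ cb : Site 2 × Fin 4} (hc₀ : E.IsStartCorner c₀) (hA : cb.1 ∈ E.zdArcA)
    (hB : cb.1 + cornerUnit (cb.2 + 1) ∈ E.zdArcB) (hIn : E.IsInEdge cb.1 (cb.2 + 1))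
    {ω : BondConfig (Site 2)} {N : ℕ}
    (hin : E.IsInnerFace (cFace (cornerOrbit (E.bcBondConfig ω) c₀ N)))
    (hout : ¬ E.IsInnerFace (cFace (cornerOrbit (E.bcBondConfig ω) c₀ (N + 1)))) :
    cornerOrbit (E.bcBondConfig ω) c₀ N = cb := by
  set p := cornerOrbit (E.bcBondConfig ω) c₀ N
  obtain ⟨-, hA', hB', hIn'⟩ := cornerOrbit_exit hE hc₀ hin hout
  have hmem : ∀ q : Site 2 × Fin 4, q.1 ∈ E.zdArcA → q.1 + cornerUnit (q.2 + 1) ∈ E.zdArcB →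
      E.IsInEdge q.1 (q.2 + 1) → cTgt q ∈ E.zdABEdges ∧ cTgt q ≠ cSrc c₀ := by
    intro q hqA hqB hqIn
    refine ⟨DiscreteDobrushin.cSrc_mem_zdABEdges hqA hqB (Or.inr hqIn), fun h => ?_⟩
    have := DiscreteDobrushin.eq_of_cSrc_eq_of_arcs hE (p := (q.1, q.2 + 1)) (q := c₀) hqA
      hc₀.mem_zdArcB h
    rw [← this] at hc₀
    exact hc₀.isOutEdge.not_isInEdge hqIn
  obtain ⟨hp₁, hp₂⟩ := hmem p hA' hB' hIn'
  obtain ⟨hb₁, hb₂⟩ := hmem cb hA hB hIn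
  have hea : cSrc c₀ ∈ E.zdABEdges :=
    DiscreteDobrushin.cSrc_mem_zdABEdges hc₀.mem_zdArcA hc₀.mem_zdArcB (Or.inl hc₀.isOutEdge)
  have htgt : cTgt p = cTgt cb := by
    rcases eq_or_eq_of_ncard_eq_two hE.ncard_zdABEdges_eq_two hea hb₁ (Ne.symm hb₂) hp₁ with h | h
    · exact absurd h hp₂
    · exact h
  have key := DiscreteDobrushin.eq_of_cSrc_eq_of_arcs hE (p := (p.1, p.2 + 1))
    (q := (cb.1, cb.2 + 1)) hA' hB htgt
  simp only [Prod.mk.injEq] at key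
  exact Prod.ext key.1 (add_right_cancel key.2)

/-- After the end corner `cb` the orbit crosses the (closed) `A`–`B` edge `e_b` into
`(cb.1, cb.2 + 1)`, for every configuration. -/
theorem cornerOrbit_succ_eq_of_eq_endCorner {E : DiscreteDobrushin} (hE : E.IsZdAdmissible)
    {c₀ cb : Site 2 × Fin 4} (hB : cb.1 + cornerUnit (cb.2 + 1) ∈ E.zdArcB)
    {ω : BondConfig (Site 2)} {N : ℕ} (hN : cornerOrbit (E.bcBondConfig ω) c₀ N = cb) :
    cornerOrbit (E.bcBondConfig ω) c₀ (N + 1) = (cb.1, cb.2 + 1) := by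
  show nextCorner (E.bcBondConfig ω) (cornerOrbit (E.bcBondConfig ω) c₀ N) = _
  rw [hN, nextCorner_of_not_mem
    (DiscreteDobrushin.not_mem_bcBondConfig_of_mem_zdArcB hE (Sym2.mem_mk_right _ _) hB)]

/-! ### Common suffix of the explorations; the reversed polylines and classes -/

section Suffix

variable {E₁ E₂ : DiscreteDobrushin} {c₁ c₂ : Site 2 × Fin 4} {ω₁ ω₂ : BondConfig (Site 2)}
  {N₁ N₂ k : ℕ}

/-- **Common list suffix.** For admissible `E₁`, `E₂` with start corners `c₁`, `c₂`, exit
indices `N₁`, `N₂` and the same corner at the exit, if going backwards from the exit the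
statuses of the source edges read agree for `j < k ≤ min N₁ N₂` steps, the REVERSED
explorations have the same first `k + 1` medial vertices, the `k`-th being
`cSrc (orb₁ (N₁ - k))`. (Smirnov 2001, §2.) -/
theorem medialExploration_reverse_take_eq (hE₁ : E₁.IsZdAdmissible) (hE₂ : E₂.IsZdAdmissible)
    (hc₁ : E₁.IsStartCorner c₁) (hc₂ : E₂.IsStartCorner c₂)
    (hN₁ : ¬ E₁.IsInnerFace (cFace (cornerOrbit (E₁.bcBondConfig ω₁) c₁ N₁)))
    (hlt₁ : ∀ n < N₁, E₁.IsInnerFace (cFace (cornerOrbit (E₁.bcBondConfig ω₁) c₁ n)))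
    (hN₂ : ¬ E₂.IsInnerFace (cFace (cornerOrbit (E₂.bcBondConfig ω₂) c₂ N₂)))
    (hlt₂ : ∀ n < N₂, E₂.IsInnerFace (cFace (cornerOrbit (E₂.bcBondConfig ω₂) c₂ n)))
    (hend : cornerOrbit (E₁.bcBondConfig ω₁) c₁ N₁ = cornerOrbit (E₂.bcBondConfig ω₂) c₂ N₂)
    (hk₁ : k ≤ N₁) (hk₂ : k ≤ N₂)
    (hstat : ∀ j < k, (cSrc (cornerOrbit (E₁.bcBondConfig ω₁) c₁ (N₁ - j)) ∈ E₁.bcBondConfig ω₁ ↔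
      cSrc (cornerOrbit (E₁.bcBondConfig ω₁) c₁ (N₁ - j)) ∈ E₂.bcBondConfig ω₂)) :
    k < (medialExploration E₁ ω₁).length ∧ k < (medialExploration E₂ ω₂).length ∧
      (medialExploration E₁ ω₁).reverse.take (k + 1) =
        (medialExploration E₂ ω₂).reverse.take (k + 1) ∧
      (medialExploration E₁ ω₁).reverse[k]? =
        some (cSrc (cornerOrbit (E₁.bcBondConfig ω₁) c₁ (N₁ - k))) := by
  have horb := cornerOrbit_sub_eq_of_agree (E₁.bcBondConfig ω₁) (E₂.bcBondConfig ω₂) c₁ c₂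
    hk₁ hk₂ hend hstat
  have heq₁ : medialExploration E₁ ω₁ = explorationList (E₁.bcBondConfig ω₁) c₁ N₁ :=
    (isMedialExploration_medialExploration_holds E₁ hE₁ ω₁).eq_explorationList hE₁ hc₁ hN₁ hlt₁
  have heq₂ : medialExploration E₂ ω₂ = explorationList (E₂.bcBondConfig ω₂) c₂ N₂ :=
    (isMedialExploration_medialExploration_holds E₂ hE₂ ω₂).eq_explorationList hE₂ hc₂ hN₂ hlt₂
  have hlen₁ : (medialExploration E₁ ω₁).length = N₁ + 1 := by rw [heq₁]; simp [explorationList]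
  have hlen₂ : (medialExploration E₂ ω₂).length = N₂ + 1 := by rw [heq₂]; simp [explorationList]
  have hget₁ : ∀ j (hj : j < (medialExploration E₁ ω₁).reverse.length),
      (medialExploration E₁ ω₁).reverse[j] = cSrc (cornerOrbit (E₁.bcBondConfig ω₁) c₁ (N₁ - j)) :=
    fun j hj => by rw [List.getElem_reverse]; simp [heq₁, explorationList]
  have hget₂ : ∀ j (hj : j < (medialExploration E₂ ω₂).reverse.length),
      (medialExploration E₂ ω₂).reverse[j] = cSrc (cornerOrbit (E₂.bcBondConfig ω₂) c₂ (N₂ - j)) :=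
    fun j hj => by rw [List.getElem_reverse]; simp [heq₂, explorationList]
  refine ⟨by omega, by omega, ?_, ?_⟩
  · apply List.ext_getElem
    · simp only [List.length_take, List.length_reverse]; omega
    · intro i h₁ h₂
      rw [List.length_take, List.length_reverse] at h₁ h₂
      rw [List.getElem_take, List.getElem_take, hget₁, hget₂, horb i (by omega)]
  · rw [List.getElem?_eq_getElem (by rw [List.length_reverse]; omega), hget₁]

/-- **The reversed exploration polylines agree as parametrised curves up to the prefix time**
`1 - 2^{-k}` (equal meshes), where they sit at `medialPoint δ (cSrc (orb₁ (N₁ - k)))`. -/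
theorem polyline_reverse_eq_of_agree (hE₁ : E₁.IsZdAdmissible) (hE₂ : E₂.IsZdAdmissible)
    (hδ : E₁.δ = E₂.δ) (hc₁ : E₁.IsStartCorner c₁) (hc₂ : E₂.IsStartCorner c₂)
    (hN₁ : ¬ E₁.IsInnerFace (cFace (cornerOrbit (E₁.bcBondConfig ω₁) c₁ N₁)))
    (hlt₁ : ∀ n < N₁, E₁.IsInnerFace (cFace (cornerOrbit (E₁.bcBondConfig ω₁) c₁ n)))
    (hN₂ : ¬ E₂.IsInnerFace (cFace (cornerOrbit (E₂.bcBondConfig ω₂) c₂ N₂)))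
    (hlt₂ : ∀ n < N₂, E₂.IsInnerFace (cFace (cornerOrbit (E₂.bcBondConfig ω₂) c₂ n)))
    (hend : cornerOrbit (E₁.bcBondConfig ω₁) c₁ N₁ = cornerOrbit (E₂.bcBondConfig ω₂) c₂ N₂)
    (hk₁ : k ≤ N₁) (hk₂ : k ≤ N₂)
    (hstat : ∀ j < k, (cSrc (cornerOrbit (E₁.bcBondConfig ω₁) c₁ (N₁ - j)) ∈ E₁.bcBondConfig ω₁ ↔
      cSrc (cornerOrbit (E₁.bcBondConfig ω₁) c₁ (N₁ - j)) ∈ E₂.bcBondConfig ω₂)) :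
    (∀ t : unitInterval, (t : ℝ) ≤ 1 - (1 / 2) ^ k →
        polyline ((medialExploration E₁ ω₁).map (medialPoint E₁.δ)).reverse t =
          polyline ((medialExploration E₂ ω₂).map (medialPoint E₂.δ)).reverse t) ∧
      polyline ((medialExploration E₁ ω₁).map (medialPoint E₁.δ)).reverse
          ⟨1 - (1 / 2) ^ k, one_sub_half_pow_mem_unitInterval k⟩ =
        medialPoint E₁.δ (cSrc (cornerOrbit (E₁.bcBondConfig ω₁) c₁ (N₁ - k))) := by
  obtain ⟨hk, -, htake, hget⟩ :=
    medialExploration_reverse_take_eq hE₁ hE₂ hc₁ hc₂ hN₁ hlt₁ hN₂ hlt₂ hend hk₁ hk₂ hstat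
  have htake' : ((medialExploration E₁ ω₁).map (medialPoint E₁.δ)).reverse.take (k + 1) =
      ((medialExploration E₂ ω₂).map (medialPoint E₂.δ)).reverse.take (k + 1) := by
    rw [← List.map_reverse, ← List.map_reverse, ← List.map_take, ← List.map_take, htake, hδ]
  have hlen : k + 1 ≤ ((medialExploration E₁ ω₁).map (medialPoint E₁.δ)).reverse.length := by
    rw [List.length_reverse, List.length_map]; omega
  refine ⟨fun t ht => polyline_eqOn_of_take_eq htake' hlen ht, ?_⟩
  rw [polyline_apply_prefixTime_eq_getElem (by rw [List.length_reverse, List.length_map]; omega)]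
  simp only [← List.map_reverse, List.getElem_map]
  congr 1
  exact (List.getElem_eq_iff (by rw [List.length_reverse]; omega)).2 hget

/-- **The interface class in the reversed orientation is the class of the reversed polyline**:
if the exploration of admissible data starts closer to `b` than to `a` (positively oriented
boundary loop, fine mesh), `bondInterfaceIn D E ω` is the class of the polyline through the
REVERSED list of medial midpoints (`orientCurve_of_lt`, `reparamDist_polyline_reverse`). -/
theorem bondInterfaceIn_eq_mk_polyline_reverse (D : DobrushinDomain) {E : DiscreteDobrushin}
    (hE : E.IsZdAdmissible) {c₀ : Site 2 × Fin 4} (hc₀ : E.IsStartCorner c₀)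
    (ho : dist (medialPoint E.δ (cSrc c₀)) (D.pt 1) < dist (medialPoint E.δ (cSrc c₀)) (D.pt 0))
    (ω : BondConfig (Site 2)) :
    bondInterfaceIn D E ω = CurveClass.mk
      (⟨polyline ((medialExploration E ω).map (medialPoint E.δ)).reverse⟩ : Curve ℂ) := by
  rw [bondInterfaceIn_apply, orientCurve_of_lt, CurveClass.mk_eq_mk.2 (reparamDist_polyline_reverse _)]
  · rfl
  · rwa [medialExplorationCurve_apply_zero hE hc₀]

/-- **Plug-in form, reversed orientation.** Under the hypotheses of
`polyline_reverse_eq_of_agree`, if both explorations start closer to `b` than to `a`, the two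
interface classes have representatives agreeing on `[0, s]` and sitting at
`medialPoint δ (cSrc (orb₁ (N₁ - k)))` at `s`. -/
theorem exists_commonPrefix_bondInterfaceIn_rev (D₁ D₂ : DobrushinDomain)
    (hE₁ : E₁.IsZdAdmissible) (hE₂ : E₂.IsZdAdmissible) (hδ : E₁.δ = E₂.δ)
    (hc₁ : E₁.IsStartCorner c₁) (hc₂ : E₂.IsStartCorner c₂)
    (ho₁ : dist (medialPoint E₁.δ (cSrc c₁)) (D₁.pt 1) < dist (medialPoint E₁.δ (cSrc c₁)) (D₁.pt 0))
    (ho₂ : dist (medialPoint E₂.δ (cSrc c₂)) (D₂.pt 1) < dist (medialPoint E₂.δ (cSrc c₂)) (D₂.pt 0))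
    (hN₁ : ¬ E₁.IsInnerFace (cFace (cornerOrbit (E₁.bcBondConfig ω₁) c₁ N₁)))
    (hlt₁ : ∀ n < N₁, E₁.IsInnerFace (cFace (cornerOrbit (E₁.bcBondConfig ω₁) c₁ n)))
    (hN₂ : ¬ E₂.IsInnerFace (cFace (cornerOrbit (E₂.bcBondConfig ω₂) c₂ N₂)))
    (hlt₂ : ∀ n < N₂, E₂.IsInnerFace (cFace (cornerOrbit (E₂.bcBondConfig ω₂) c₂ n)))
    (hend : cornerOrbit (E₁.bcBondConfig ω₁) c₁ N₁ = cornerOrbit (E₂.bcBondConfig ω₂) c₂ N₂)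
    (hk₁ : k ≤ N₁) (hk₂ : k ≤ N₂)
    (hstat : ∀ j < k, (cSrc (cornerOrbit (E₁.bcBondConfig ω₁) c₁ (N₁ - j)) ∈ E₁.bcBondConfig ω₁ ↔
      cSrc (cornerOrbit (E₁.bcBondConfig ω₁) c₁ (N₁ - j)) ∈ E₂.bcBondConfig ω₂)) :
    ∃ (c c' : Curve ℂ) (s : unitInterval), CurveClass.mk c = bondInterfaceIn D₁ E₁ ω₁ ∧
      CurveClass.mk c' = bondInterfaceIn D₂ E₂ ω₂ ∧ (∀ t : unitInterval, t ≤ s → c t = c' t) ∧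
      c s = medialPoint E₁.δ (cSrc (cornerOrbit (E₁.bcBondConfig ω₁) c₁ (N₁ - k))) := by
  obtain ⟨hagree, hendpt⟩ :=
    polyline_reverse_eq_of_agree hE₁ hE₂ hδ hc₁ hc₂ hN₁ hlt₁ hN₂ hlt₂ hend hk₁ hk₂ hstat
  exact ⟨⟨polyline ((medialExploration E₁ ω₁).map (medialPoint E₁.δ)).reverse⟩,
    ⟨polyline ((medialExploration E₂ ω₂).map (medialPoint E₂.δ)).reverse⟩,
    ⟨1 - (1 / 2) ^ k, one_sub_half_pow_mem_unitInterval k⟩,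
    (bondInterfaceIn_eq_mk_polyline_reverse D₁ hE₁ hc₁ ho₁ ω₁).symm,
    (bondInterfaceIn_eq_mk_polyline_reverse D₂ hE₂ hc₂ ho₂ ω₂).symm, fun t ht => hagree t ht, hendpt⟩

/-! ### First backward divergence -/

/-- **First backward divergence of two explorations with a common exit corner.** Either the two
explorations are the same list, or after some `k ≤ min N₁ N₂` backward steps during which the
statuses of the source edges read agree, at the corner `q = orb₁ (N₁ - k) = orb₂ (N₂ - k)` either
the status of `cSrc q` differs, or (one orbit is back at its start corner, the other continues
backwards through the outer face of that start edge) the face `faceAt q.1 (q.2 + 3)` before `q`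
around its vertex is inner for exactly one of the two data. (Smirnov 2001, §2.) -/
theorem medialExploration_eq_or_diverge_rev (hE₁ : E₁.IsZdAdmissible) (hE₂ : E₂.IsZdAdmissible)
    (hc₁ : E₁.IsStartCorner c₁) (hc₂ : E₂.IsStartCorner c₂)
    (hN₁ : ¬ E₁.IsInnerFace (cFace (cornerOrbit (E₁.bcBondConfig ω₁) c₁ N₁)))
    (hlt₁ : ∀ n < N₁, E₁.IsInnerFace (cFace (cornerOrbit (E₁.bcBondConfig ω₁) c₁ n)))
    (hN₂ : ¬ E₂.IsInnerFace (cFace (cornerOrbit (E₂.bcBondConfig ω₂) c₂ N₂)))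
    (hlt₂ : ∀ n < N₂, E₂.IsInnerFace (cFace (cornerOrbit (E₂.bcBondConfig ω₂) c₂ n)))
    (hend : cornerOrbit (E₁.bcBondConfig ω₁) c₁ N₁ = cornerOrbit (E₂.bcBondConfig ω₂) c₂ N₂) :
    medialExploration E₁ ω₁ = medialExploration E₂ ω₂ ∨
      ∃ k, k ≤ N₁ ∧ k ≤ N₂ ∧
        (∀ j < k, (cSrc (cornerOrbit (E₁.bcBondConfig ω₁) c₁ (N₁ - j)) ∈ E₁.bcBondConfig ω₁ ↔
          cSrc (cornerOrbit (E₁.bcBondConfig ω₁) c₁ (N₁ - j)) ∈ E₂.bcBondConfig ω₂)) ∧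
        (¬ (cSrc (cornerOrbit (E₁.bcBondConfig ω₁) c₁ (N₁ - k)) ∈ E₁.bcBondConfig ω₁ ↔
            cSrc (cornerOrbit (E₁.bcBondConfig ω₁) c₁ (N₁ - k)) ∈ E₂.bcBondConfig ω₂) ∨
          ¬ (E₁.IsInnerFace (faceAt (cornerOrbit (E₁.bcBondConfig ω₁) c₁ (N₁ - k)).1
                ((cornerOrbit (E₁.bcBondConfig ω₁) c₁ (N₁ - k)).2 + 3)) ↔
              E₂.IsInnerFace (faceAt (cornerOrbit (E₁.bcBondConfig ω₁) c₁ (N₁ - k)).1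
                ((cornerOrbit (E₁.bcBondConfig ω₁) c₁ (N₁ - k)).2 + 3)))) := by
  classical
  set β₁ := E₁.bcBondConfig ω₁
  set β₂ := E₂.bcBondConfig ω₂
  let P : ℕ → Prop := fun j =>
    (cSrc (cornerOrbit β₁ c₁ (N₁ - j)) ∈ β₁ ↔ cSrc (cornerOrbit β₁ c₁ (N₁ - j)) ∈ β₂) ∧ j < N₁ ∧ j < N₂
  have hex : ∃ j, ¬ P j := ⟨N₁, fun h => lt_irrefl _ h.2.1⟩
  set k := Nat.find hex
  have hbefore : ∀ j < k, P j := fun j hj => not_not.1 (Nat.find_min hex hj)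
  have hat : ¬ P k := Nat.find_spec hex
  have hk : k ≤ N₁ ∧ k ≤ N₂ := by
    rcases Nat.eq_zero_or_pos k with h0 | hpos
    · omega
    · have := (hbefore (k - 1) (by omega)).2; omega
  have hstat : ∀ j < k, (cSrc (cornerOrbit β₁ c₁ (N₁ - j)) ∈ β₁ ↔
      cSrc (cornerOrbit β₁ c₁ (N₁ - j)) ∈ β₂) := fun j hj => (hbefore j hj).1
  have horb := cornerOrbit_sub_eq_of_agree β₁ β₂ c₁ c₂ hk.1 hk.2 hend hstat
  by_cases hQ : (cSrc (cornerOrbit β₁ c₁ (N₁ - k)) ∈ β₁ ↔ cSrc (cornerOrbit β₁ c₁ (N₁ - k)) ∈ β₂)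
  swap
  · exact Or.inr ⟨k, hk.1, hk.2, hstat, Or.inl hQ⟩
  have hkN : k = N₁ ∨ k = N₂ := by
    by_contra h
    exact hat ⟨hQ, lt_of_le_of_ne hk.1 fun h' => h (Or.inl h'),
      lt_of_le_of_ne hk.2 fun h' => h (Or.inr h')⟩
  rcases Nat.lt_trichotomy N₁ N₂ with hlt | heq | hgt
  · -- `k = N₁ < N₂`: orbit 1 is back at its start corner, orbit 2 continues backwards
    have hq : cornerOrbit β₁ c₁ (N₁ - k) = c₁ := by
      rw [show k = N₁ by omega, Nat.sub_self]; rfl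
    refine Or.inr ⟨k, hk.1, hk.2, hstat, Or.inr ?_⟩
    rw [hq]
    intro hiff
    obtain ⟨m, hm⟩ : ∃ m, N₂ - k = m + 1 := ⟨N₂ - k - 1, by omega⟩
    have hpred : cornerOrbit β₂ c₂ m = (c₁.1, c₁.2 + 3) :=
      eq_crossPred_of_nextCorner_eq
        (show cornerOrbit β₂ c₂ (m + 1) = c₁ by rw [← hm, ← horb k le_rfl, hq])
        fun h => cSrc_start_not_mem hE₁ hc₁ ((hq ▸ hQ).2 h)
    have hin₂ := hlt₂ m (by omega)
    rw [hpred] at hin₂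
    exact hc₁.isOutEdge.2 (hiff.2 hin₂)
  · -- `N₁ = N₂ = k`: the orbits agree all the way back, the explorations coincide
    subst heq
    left
    rw [(isMedialExploration_medialExploration_holds E₁ hE₁ ω₁).eq_explorationList hE₁ hc₁ hN₁ hlt₁,
      (isMedialExploration_medialExploration_holds E₂ hE₂ ω₂).eq_explorationList hE₂ hc₂ hN₂ hlt₂]
    refine explorationList_eq_of_cornerOrbit_eq β₁ β₂ c₁ c₂ fun n hn => ?_
    have := horb (N₁ - n) (by omega)
    rwa [show N₁ - (N₁ - n) = n by omega] at this
  · -- `k = N₂ < N₁`: symmetric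
    have hq : cornerOrbit β₁ c₁ (N₁ - k) = c₂ := by
      rw [horb k le_rfl, show k = N₂ by omega, Nat.sub_self]; rfl
    refine Or.inr ⟨k, hk.1, hk.2, hstat, Or.inr ?_⟩
    rw [hq]
    intro hiff
    obtain ⟨m, hm⟩ : ∃ m, N₁ - k = m + 1 := ⟨N₁ - k - 1, by omega⟩
    have hpred : cornerOrbit β₁ c₁ m = (c₂.1, c₂.2 + 3) :=
      eq_crossPred_of_nextCorner_eq (show cornerOrbit β₁ c₁ (m + 1) = c₂ by rw [← hm, hq])
        fun h => cSrc_start_not_mem hE₂ hc₂ ((hq ▸ hQ).1 h)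
    have hin₁ := hlt₁ m (by omega)
    rw [hpred] at hin₁
    exact hc₂.isOutEdge.2 (hiff.1 hin₁)

end Suffix

/-! ### Compatible data: equal interfaces or a common prefix ending at an incompatible vertex -/

/-- **Exact lattice locality, deterministic form, reversed orientation.** For admissible `E₁`,
`E₂` with the same mesh, start corners `c₁`, `c₂` whose source midpoints are closer to `b` than
to `a` (so that `bondInterfaceIn` time-reverses both explorations), a common END corner `cb`
(vertex on `A`, far endpoint of the target edge on `B`, target edge targeted at the vertex — for
both data) and a set `U` of sites at which the two completed configurations agree (statuses of
the four edges, innerness of the four faces): either the two interface classes coincide, or they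
have representatives agreeing on `[0, s]` and sitting at `s` at the midpoint of the source edge
of a corner whose vertex is NOT in `U`.  Companion of `bondInterfaceIn_eq_or_commonPrefix` for
positively oriented boundary loops. (Smirnov 2001, §2.) -/
theorem bondInterfaceIn_eq_or_commonPrefix_rev (D₁ D₂ : DobrushinDomain) {E₁ E₂ : DiscreteDobrushin}
    (hE₁ : E₁.IsZdAdmissible) (hE₂ : E₂.IsZdAdmissible) (hδ : E₁.δ = E₂.δ)
    {c₁ c₂ cb : Site 2 × Fin 4} (hc₁ : E₁.IsStartCorner c₁) (hc₂ : E₂.IsStartCorner c₂)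
    (hA₁ : cb.1 ∈ E₁.zdArcA) (hB₁ : cb.1 + cornerUnit (cb.2 + 1) ∈ E₁.zdArcB)
    (hIn₁ : E₁.IsInEdge cb.1 (cb.2 + 1))
    (hA₂ : cb.1 ∈ E₂.zdArcA) (hB₂ : cb.1 + cornerUnit (cb.2 + 1) ∈ E₂.zdArcB)
    (hIn₂ : E₂.IsInEdge cb.1 (cb.2 + 1))
    (ho₁ : dist (medialPoint E₁.δ (cSrc c₁)) (D₁.pt 1) < dist (medialPoint E₁.δ (cSrc c₁)) (D₁.pt 0))
    (ho₂ : dist (medialPoint E₂.δ (cSrc c₂)) (D₂.pt 1) < dist (medialPoint E₂.δ (cSrc c₂)) (D₂.pt 0))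
    (U : Set (Site 2)) {ω₁ ω₂ : BondConfig (Site 2)}
    (hU : ∀ p : Site 2 × Fin 4, p.1 ∈ U →
      ((cTgt p ∈ E₁.bcBondConfig ω₁ ↔ cTgt p ∈ E₂.bcBondConfig ω₂) ∧
        (E₁.IsInnerFace (cFace p) ↔ E₂.IsInnerFace (cFace p)))) :
    bondInterfaceIn D₁ E₁ ω₁ = bondInterfaceIn D₂ E₂ ω₂ ∨
      ∃ (c c' : Curve ℂ) (s : unitInterval) (p : Site 2 × Fin 4),
        CurveClass.mk c = bondInterfaceIn D₁ E₁ ω₁ ∧ CurveClass.mk c' = bondInterfaceIn D₂ E₂ ω₂ ∧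
        (∀ t : unitInterval, t ≤ s → c t = c' t) ∧ c s = medialPoint E₁.δ (cSrc p) ∧ p.1 ∉ U := by
  obtain ⟨N₁, hN₁, hlt₁, -⟩ := exists_medialExploration_eq_explorationList hE₁ hc₁ ω₁
  obtain ⟨N₂, hN₂, hlt₂, -⟩ := exists_medialExploration_eq_explorationList hE₂ hc₂ ω₂
  -- both orbits pass through the end corner just before the exit, hence agree at the exit
  obtain ⟨M₁, rfl⟩ := Nat.exists_eq_succ_of_ne_zero (n := N₁) (by rintro rfl; exact hN₁ hc₁.isOutEdge.1)
  obtain ⟨M₂, rfl⟩ := Nat.exists_eq_succ_of_ne_zero (n := N₂) (by rintro rfl; exact hN₂ hc₂.isOutEdge.1)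
  have hend : cornerOrbit (E₁.bcBondConfig ω₁) c₁ (M₁ + 1) =
      cornerOrbit (E₂.bcBondConfig ω₂) c₂ (M₂ + 1) := by
    rw [cornerOrbit_succ_eq_of_eq_endCorner hE₁ hB₁
        (cornerOrbit_eq_endCorner hE₁ hc₁ hA₁ hB₁ hIn₁ (hlt₁ M₁ (Nat.lt_succ_self _)) hN₁),
      cornerOrbit_succ_eq_of_eq_endCorner hE₂ hB₂
        (cornerOrbit_eq_endCorner hE₂ hc₂ hA₂ hB₂ hIn₂ (hlt₂ M₂ (Nat.lt_succ_self _)) hN₂)]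
  rcases medialExploration_eq_or_diverge_rev hE₁ hE₂ hc₁ hc₂ hN₁ hlt₁ hN₂ hlt₂ hend with
    heq | ⟨k, hk₁, hk₂, hstat, hdiv⟩
  · left
    rw [bondInterfaceIn_eq_mk_polyline_reverse D₁ hE₁ hc₁ ho₁,
      bondInterfaceIn_eq_mk_polyline_reverse D₂ hE₂ hc₂ ho₂, heq, hδ]
  · right
    obtain ⟨c, c', s, h1, h2, h3, h4⟩ := exists_commonPrefix_bondInterfaceIn_rev D₁ D₂ hE₁ hE₂ hδ
      hc₁ hc₂ ho₁ ho₂ hN₁ hlt₁ hN₂ hlt₂ hend hk₁ hk₂ hstat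
    set q := cornerOrbit (E₁.bcBondConfig ω₁) c₁ (M₁ + 1 - k)
    refine ⟨c, c', s, q, h1, h2, h3, h4, fun hmem => ?_⟩
    obtain ⟨hs, hf⟩ := hU (q.1, q.2 + 3) hmem
    rw [cTgt_crossPred] at hs
    rcases hdiv with h | h
    · exact h hs
    · exact h hf

/-- **Registered sub-goal stub `stub_discreteLocality_explorationSuffix`** of
`stub_discreteLocality` (crux `LagHandOff`, line `crosscut-dictionary`): the deterministic
exploration-suffix groundwork `bondInterfaceIn_eq_or_commonPrefix_rev`, fully quantified. -/
theorem stub_discreteLocality_explorationSuffix : ∀ (D₁ D₂ : DobrushinDomain) (E₁ E₂ : DiscreteDobrushin), E₁.IsZdAdmissible → E₂.IsZdAdmissible → E₁.δ = E₂.δ → ∀ c₁ c₂ cb : Site 2 × Fin 4, E₁.IsStartCorner c₁ → E₂.IsStartCorner c₂ → cb.1 ∈ E₁.zdArcA → cb.1 + cornerUnit (cb.2 + 1) ∈ E₁.zdArcB → E₁.IsInEdge cb.1 (cb.2 + 1) → cb.1 ∈ E₂.zdArcA → cb.1 + cornerUnit (cb.2 + 1) ∈ E₂.zdArcB → E₂.IsInEdge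 cb.1 (cb.2 + 1) → dist (medialPoint E₁.δ (cSrc c₁)) (D₁.pt 1) < dist (medialPoint E₁.δ (cSrc c₁)) (D₁.pt 0) → dist (medialPoint E₂.δ (cSrc c₂)) (D₂.pt 1) < dist (medialPoint E₂.δ (cSrc c₂)) (D₂.pt 0) → ∀ (U : Set (Site 2)) (ω₁ ω₂ : BondConfig (Site 2)), (∀ p : Site 2 × Fin 4, p.1 ∈ U → ((cTgt p ∈ E₁.bcBondConfig ω₁ ↔ cTgt p ∈ E₂.bcBondConfig ω₂) ∧ (E₁.IsInnerFace (cFace p) ↔ E₂.IsInnerFace (cFace p)))) → bondInterfaceIn D₁ E₁ ω₁ = bondInterfaceIn D₂ E₂ ω₂ ∨ ∃ (c c' : Curve ℂ) (s : unitInterval) (p : Site 2 × Fin 4), CurveClass.mk c = bondInterfaceIn D₁ E₁ ω₁ ∧ CurveClass.mk c' = bondInterfaceIn D₂ E₂ ω₂ ∧ (∀ t : unitInterval, t ≤ s → c t = c' t) ∧ c s = medialPoint E₁.δ (cSrc p) ∧ p.1 ∉ U :=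
  fun D₁ D₂ _ _ hE₁ hE₂ hδ _ _ _ hc₁ hc₂ hA₁ hB₁ hIn₁ hA₂ hB₂ hIn₂ ho₁ ho₂ U _ _ hU =>
    bondInterfaceIn_eq_or_commonPrefix_rev D₁ D₂ hE₁ hE₂ hδ hc₁ hc₂ hA₁ hB₁ hIn₁ hA₂ hB₂ hIn₂
      ho₁ ho₂ U hU

end Summit.CriticalPhenomena.CardyFormulaZ2.Cruxes.LagHandOff.CrosscutDictionary

end
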